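import Mathlib.Analysis.Calculus.InverseFunctionTheorem.ContDiff
import Mathlib.Analysis.Calculus.FDeriv.Mul
import Mathlib.Analysis.Calculus.ContDiff.Operations

/-!
# The smooth square root near `1` in a Banach algebra

In a complete normed `ℝ`-algebra `𝔸` (e.g. `V →L[ℝ] V`), the squaring map `X ↦ X * X` has
derivative `H ↦ 2H` at `1`, an isomorphism; the inverse function theorem gives a local inverse
`R` (Mathlib's `HasStrictFDerivAt.localInverse`) — the square root near `1`:

* `hasStrictFDerivAt_mul_self_one`: the derivative of squaring at `1` is `2 • id`
  (as the continuous linear equivalence `ContinuousLinearEquiv.smulLeft (Units.mk0 2 _)`);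
* `eventually_localSqrt_mul_self`: `R X * R X = X` near `1`; `localSqrt_one`: `R 1 = 1`;
  `contDiffAt_localSqrt`, `hasStrictFDerivAt_localSqrt` (`DR(1) = ½ id`);
* `eventually_eq_localSqrt_of_mul_self_eq` (**uniqueness**): near `1`, any `Y` with `Y * Y = X`
  is `R X` (injectivity of squaring near `1`);
* consequences by uniqueness: `R X` commutes with every *invertible* element conjugating `X` to
  itself near `1` (`eventually_localSqrt_conj`), and with every continuous multiplicative
  anti-involution fixing `X` (applied downstream to the adjoint: the square root of a
  self-adjoint operator near `1` is self-adjoint, `eventually_localSqrt_star`).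

This is the functional-analytic input of the *polar/osculating frame* used for Voisin's
Prop. 6.5 (Kähler identities via osculating coordinates, Voisin (2002), Prop. 3.14): the
positive square root `Q^{1/2}` of the Gram operator `Q = 1 + O(|z|²)` of an osculating metric.

## References

* C. Voisin, *Hodge Theory and Complex Algebraic Geometry I* (2002), Prop. 3.14, Prop. 6.5.
  [Voisin2002]
* (Inverse function theorem) Mathlib, `Mathlib/Analysis/Calculus/InverseFunctionTheorem/`.
-/

noncomputable section

open scoped Topology ContDiff
open Filter

namespace Literature.Analysis.OperatorTheory

variable {𝔸 : Type*} [NormedRing 𝔸] [NormedAlgebra ℝ 𝔸] [CompleteSpace 𝔸]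

omit [CompleteSpace 𝔸] in
/-- **The derivative of squaring at `1` is doubling**: `X ↦ X * X` has strict derivative
`H ↦ 2 • H` at `1`, written as the continuous linear equivalence of scalar multiplication by the
unit `2`. [folklore] -/
theorem hasStrictFDerivAt_mul_self_one :
    HasStrictFDerivAt (fun X : 𝔸 ↦ X * X)
      ((ContinuousLinearEquiv.smulLeft (Units.mk0 (2 : ℝ) two_ne_zero) : 𝔸 ≃L[ℝ] 𝔸) :
        𝔸 →L[ℝ] 𝔸) 1 := by
  have h := (hasStrictFDerivAt_id (𝕜 := ℝ) (1 : 𝔸)).mul' (hasStrictFDerivAt_id (𝕜 := ℝ) (1 : 𝔸))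
  refine h.congr_fderiv ?_
  ext H
  simp [Units.smul_def, two_smul]

set_option quotPrecheck false in
/-- The local square root near `1`: the local inverse of squaring given by the inverse function
theorem at `1`. -/
local notation "√₁" => HasStrictFDerivAt.localInverse (fun X : 𝔸 ↦ X * X)
  (ContinuousLinearEquiv.smulLeft (Units.mk0 (2 : ℝ) two_ne_zero) : 𝔸 ≃L[ℝ] 𝔸) 1
  hasStrictFDerivAt_mul_self_one

/-- **`√X · √X = X` near `1`.** [folklore] -/
theorem eventually_localSqrt_mul_self : ∀ᶠ X in 𝓝 (1 : 𝔸), √₁ X * √₁ X = X := by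
  simpa using (hasStrictFDerivAt_mul_self_one (𝔸 := 𝔸)).eventually_right_inverse

/-- **`√1 = 1`.** [folklore] -/
theorem localSqrt_one : √₁ (1 : 𝔸) = 1 := by
  simpa using (hasStrictFDerivAt_mul_self_one (𝔸 := 𝔸)).localInverse_apply_image

/-- **Uniqueness of the square root near `1`**: for `Y` near `1`, `√(Y · Y) = Y`; hence any
`Y` near `1` with `Y · Y = X` equals `√X`. [folklore] -/
theorem eventually_localSqrt_of_mul_self : ∀ᶠ Y in 𝓝 (1 : 𝔸), √₁ (Y * Y) = Y :=
  (hasStrictFDerivAt_mul_self_one (𝔸 := 𝔸)).eventually_left_inverse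

/-- The square root is continuous at `1`. [folklore] -/
theorem continuousAt_localSqrt : ContinuousAt (fun X : 𝔸 ↦ √₁ X) 1 := by
  simpa using (hasStrictFDerivAt_mul_self_one (𝔸 := 𝔸)).localInverse_continuousAt

/-- **The square root is `C^∞` at `1`** (inverse function theorem). [folklore] -/
theorem contDiffAt_localSqrt : ContDiffAt ℝ ∞ (fun X : 𝔸 ↦ √₁ X) 1 := by
  have hf : ContDiffAt ℝ ∞ (fun X : 𝔸 ↦ X * X) 1 := contDiffAt_id.mul contDiffAt_id
  have h := hf.to_localInverse (hasStrictFDerivAt_mul_self_one (𝔸 := 𝔸)).hasFDerivAt (by simp)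
  simp only [ContDiffAt.localInverse, mul_one] at h
  exact h

/-- **`D√(1) = ½`**: the strict derivative of the square root at `1` is the inverse of doubling.
[folklore] -/
theorem hasStrictFDerivAt_localSqrt :
    HasStrictFDerivAt (fun X : 𝔸 ↦ √₁ X)
      ((ContinuousLinearEquiv.smulLeft (Units.mk0 (2 : ℝ) two_ne_zero) : 𝔸 ≃L[ℝ] 𝔸).symm :
        𝔸 →L[ℝ] 𝔸) 1 := by
  simpa using (hasStrictFDerivAt_mul_self_one (𝔸 := 𝔸)).to_localInverse

/-- **The square root commutes with the symmetries of its argument** (by uniqueness): for a unit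
`J` and `X` near `1` commuting with `J`, `√X` commutes with `J` (`J √X J⁻¹` is a square root of
`J X J⁻¹ = X` close to `1`). Downstream: `J` the complex structure, `X` the Gram operator of a
Hermitian metric. [folklore] -/
theorem eventually_localSqrt_comm_units (J : 𝔸ˣ) :
    ∀ᶠ X in 𝓝 (1 : 𝔸), ((J : 𝔸) * X = X * J → (J : 𝔸) * √₁ X = √₁ X * J) := by
  -- conjugation by `J` is continuous and fixes `1`; pull back the uniqueness neighbourhood
  have hc : ContinuousAt (fun X : 𝔸 ↦ (J : 𝔸) * √₁ X * ↑J⁻¹) 1 :=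
    ((continuousAt_const.mul continuousAt_localSqrt).mul continuousAt_const)
  have ht : ∀ᶠ Y in 𝓝 ((fun X : 𝔸 ↦ (J : 𝔸) * √₁ X * ↑J⁻¹) 1), √₁ (Y * Y) = Y := by
    simp only [localSqrt_one, mul_one, Units.mul_inv]
    exact eventually_localSqrt_of_mul_self
  filter_upwards [hc.eventually ht, eventually_localSqrt_mul_self (𝔸 := 𝔸)] with X hX hXX hJX
  -- `Y = J √X J⁻¹` squares to `X`, hence is `√X`
  have hY : ((J : 𝔸) * √₁ X * ↑J⁻¹) * ((J : 𝔸) * √₁ X * ↑J⁻¹) = X := by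
    calc ((J : 𝔸) * √₁ X * ↑J⁻¹) * ((J : 𝔸) * √₁ X * ↑J⁻¹)
        = ↑J * (√₁ X * (↑J⁻¹ * ↑J) * √₁ X) * ↑J⁻¹ := by noncomm_ring
      _ = ↑J * X * ↑J⁻¹ := by rw [Units.inv_mul, mul_one, hXX]
      _ = X := by rw [hJX, mul_assoc, Units.mul_inv, mul_one]
  have hR : √₁ X = (J : 𝔸) * √₁ X * ↑J⁻¹ := by
    rw [hY] at hX
    exact hX
  calc (J : 𝔸) * √₁ X = (J : 𝔸) * √₁ X * ↑J⁻¹ * ↑J := by rw [mul_assoc, Units.inv_mul, mul_one]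
    _ = √₁ X * ↑J := by rw [← hR]

/-- **The square root of a self-adjoint element is self-adjoint** (by uniqueness), for a
continuous star operation: if `star X = X` and `X` is near `1` then `star (√X) = √X`
(`star √X` is a square root of `star X = X` close to `1`). Downstream: `𝔸 = V →L[ℝ] V`, `star` the
adjoint, `X` the Gram operator of a metric. [folklore] -/
theorem eventually_localSqrt_star [StarRing 𝔸] [ContinuousStar 𝔸] :
    ∀ᶠ X in 𝓝 (1 : 𝔸), (star X = X → star (√₁ X) = √₁ X) := by
  have hc : ContinuousAt (fun X : 𝔸 ↦ star (√₁ X)) 1 := continuousAt_star.comp continuousAt_localSqrt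
  have ht : ∀ᶠ Y in 𝓝 ((fun X : 𝔸 ↦ star (√₁ X)) 1), √₁ (Y * Y) = Y := by
    simp only [localSqrt_one, star_one]
    exact eventually_localSqrt_of_mul_self
  filter_upwards [hc.eventually ht, eventually_localSqrt_mul_self (𝔸 := 𝔸)] with X hX hXX hsX
  have hY : star (√₁ X) * star (√₁ X) = X := by rw [← star_mul, hXX, hsX]
  rw [hY] at hX
  exact hX.symm

end Literature.Analysis.OperatorTheory
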